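import Literature.IUT.HodgeTheaters.TemperedCoveringsByName
import Literature.AnabelianGeometry.SemiGraphs.NodNonVerticialGeometry
import HarnessLib

/-!
# [IUTchI] Prop. 2.1 / 2.2: the input (A3) BY NAME — [NodNon] Lemma 1.9 (ii) over a `PSCDatum` on `Π̂_𝔾`

Mochizuki, *Inter-universal Teichmüller theory I*, kurims manuscript (May 2020), §2, proof of
Proposition 2.1, p. 45: "it follows either from [AbsTopII], Proposition 1.3, (iv), or from [NodNon],
Proposition 3.9, (i), that …" [cite: Mochizuki2012, Prop 2.1 p.45] (D-0012 claim key; nothing of the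
series is asserted here).  PROOF-ONLY continuation of `TemperedCoveringsProTree.lean` /
`TemperedCoveringsByName.lean` (abc-iut-L5-t11): there the input (A3) of the Prop. 2.1 kernel was
the hypothesis `hA3`, [NodNon] Lemma 1.9 (ii) written out in coset coordinates on `Π̂_𝔾`.  Here (A3)
is consumed BY NAME: from the tree's typed [NodNon] Lemma 1.9 (ii), the predicate
`SemiGraphs.PSCDatum.VerticialIntersectionNear` of a `PSCDatum` on `Π̂_𝔾 = D.Hat` ([CombGC] Def. 1.1
(ii), abc-iut-L3-t4's `PSCFundamentalGroup.lean`), under the DICTIONARY identifying the chosen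
verticial subgroups `Λ_v ⊆ Π^tp_𝔾` of the kernel with the datum's representatives (`ι(Λ_v) = Π_v`,
compact hence closed images) and tempered end-point data for the nodes
(`TemperedGraphGroupData.hA3_of_verticialIntersectionNear`).

Main declarations: `TemperedGraphGroupData.prop21_of_psc`, `….tp_isCommensurablyTerminal_of_psc`
(and `….temperedNormallyTerminal_of_psc`, Rmk. 2.2.2) — Prop. 2.1 AS TYPED / Prop. 2.2 "in
particular" with (A3) := `VerticialIntersectionNear` BY NAME; the other inputs as in
`prop21_of_cosetTree_of_isTempered` ((A1), temperedness, (RF): BY NAME from a chart /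
`IsProfiniteCompletion` in `TemperedCoveringsCharts.lean` / `TemperedCoveringsCompletion.lean`).
Final assembly `TemperedGraphGroupData.prop21_byName` / `….prop22_inParticular_byName`: EVERY input
of the printed proof BY NAME (chart: [SemiAnbd] Thm 3.7 (i)/(iii), totally elevated, Prop 3.6 (i);
`IsProfiniteCompletion`; L3's Galois-domination hypothesis; `PSCDatum.VerticialIntersectionNear`),
the only other arguments being identification / dictionary data. Not a discharge of the node
IUTchI:Prop2.1 (the predicate is a named [NodNon] input, FACT-policy); typed ≠ discharged; nothing
here bears on [IUTchIII] Cor. 3.12.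
-/

namespace Literature.IUT.HodgeTheaters

open Pointwise Filter
open _root_.Topology
open Literature.AnabelianGeometry.SemiGraphs (IsTempered IsProfiniteCompletion PSCDatum ProfiniteSemiGraph)
open Literature.AnabelianGeometry.SemiGraphs.ProfiniteSemiGraph (TemperedPiChart verticialSubgroups
  CompactInVerticial VerticialInjective)
open Literature.AnabelianGeometry.AbsoluteAnabelian (IsCommensurablyTerminal)

universe u

namespace TemperedGraphGroupData

variable (D : TemperedGraphGroupData.{u})

/-- **(A3) BY NAME.**  Let `G` be a `PSCDatum` on `Π̂_𝔾` whose representative verticial subgroups are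
the images `ι(Λ_v)` of the chosen (compact) verticial subgroups `Λ_v ⊆ Π^tp_𝔾`, and let tempered
end-point data for the nodes be given (`src`, `tgt`, `c₁ c₂ : Node(𝔾) → Π^tp_𝔾` with
`Π_e ⊆ ι(cᵢ(e)) Π_{vᵢ} ι(cᵢ(e))⁻¹` and distinct end-points for loops — [NodNon] Rmk. 1.2.1 (iii),
`𝒱(ẽ)^♯ = 2`).  Then [NodNon] Lemma 1.9 (ii)
for `G` (`VerticialIntersectionNear`) yields the hypothesis (A3) of `prop21_of_cosetTree` verbatim.
[cite: HoshiMochizukiNodNon2011, Lem 1.9 (ii) p.291] -/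
theorem hA3_of_verticialIntersectionNear (G : PSCDatum D.Hat) (hNN : G.VerticialIntersectionNear)
    (Λv : G.graph.V → Subgroup D.Tp) (hΛv : ∀ v, (Λv v).map D.ι = G.vertGp v)
    (src tgt : G.graph.N → G.graph.V) (c₁ c₂ : G.graph.N → D.Tp)
    (hends : ∀ e, G.graph.nodeEnds e = s(src e, tgt e))
    (h₁ : ∀ e, G.nodeGp e ≤ MulAut.conj (D.ι (c₁ e)) • G.vertGp (src e))
    (h₂ : ∀ e, G.nodeGp e ≤ MulAut.conj (D.ι (c₂ e)) • G.vertGp (tgt e))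
    (hloop : ∀ e, src e = tgt e → (c₁ e)⁻¹ * c₂ e ∉ Λv (src e)) :
    ∀ (v w : G.graph.V) (g h : D.Hat),
      MulAut.conj g • (Λv v).map D.ι ⊓ MulAut.conj h • (Λv w).map D.ι ≠ ⊥ →
        (v = w ∧ g⁻¹ * h ∈ (Λv v).map D.ι) ∨
        ∃ (e : G.graph.N) (k : D.Hat), ∃ p ∈ (Λv (src e)).map D.ι, ∃ q ∈ (Λv (tgt e)).map D.ι,
          (src e = v ∧ tgt e = w ∧ g = k * D.ι (c₁ e) * p ∧ h = k * D.ι (c₂ e) * q) ∨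
          (src e = w ∧ tgt e = v ∧ h = k * D.ι (c₁ e) * p ∧ g = k * D.ι (c₂ e) * q) := by
  -- the tempered end-point data, read in `Π̂_𝔾`
  let ε : G.EndpointData :=
    { src := src
      tgt := tgt
      c₁ := fun e => D.ι (c₁ e)
      c₂ := fun e => D.ι (c₂ e)
      nodeEnds_eq := hends
      nodeGp_le_src := h₁
      nodeGp_le_tgt := h₂
      loop_ne := fun e he hmem => by
        rw [← hΛv, ← map_inv, ← map_mul, Subgroup.mem_map_iff_mem D.ι_injective] at hmem
        exact hloop e he hmem }
  intro v w g h hne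
  rw [hΛv, hΛv] at hne
  rcases hNN ε v w g h hne with ⟨hvw, hgh⟩ | ⟨e, k, p, hp, q, hq, hcase⟩
  · exact Or.inl ⟨hvw, by rwa [hΛv]⟩
  · exact Or.inr ⟨e, k, p, by rwa [hΛv], q, by rwa [hΛv], hcase⟩

/-- **[IUTchI] Proposition 2.1 for `D`, (A3) BY NAME from [NodNon] Lemma 1.9 (ii)** (`PSCDatum`
predicate `VerticialIntersectionNear`), the other inputs as in `prop21_of_cosetTree_of_isTempered`:
temperedness of `Π^tp_𝔾`, Hausdorffness of `Π̂_𝔾`, (RF), and (A1) ([SemiAnbd] Thm 3.7 (iii)) for the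
verticial family `Λ_v` of the dictionary. ([IUTchI] Prop 2.1 p.45) [claim: Mochizuki2012, status: disputed] -/
theorem prop21_of_psc [T2Space D.Hat] (hT : IsTempered D.Tp)
    (hRF : ∀ U ∈ 𝓝 (1 : D.Tp), ∃ N : OpenNormalSubgroup D.Tp, (N : Set D.Tp) ⊆ U ∧
      ((N.toSubgroup.map D.ι).topologicalClosure).comap D.ι ≤ N.toSubgroup)
    (G : PSCDatum D.Hat) (hNN : G.VerticialIntersectionNear)
    (Λv : G.graph.V → Subgroup D.Tp) (hΛv : ∀ v, (Λv v).map D.ι = G.vertGp v)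
    (src tgt : G.graph.N → G.graph.V) (c₁ c₂ : G.graph.N → D.Tp)
    (hends : ∀ e, G.graph.nodeEnds e = s(src e, tgt e))
    (h₁ : ∀ e, G.nodeGp e ≤ MulAut.conj (D.ι (c₁ e)) • G.vertGp (src e))
    (h₂ : ∀ e, G.nodeGp e ≤ MulAut.conj (D.ι (c₂ e)) • G.vertGp (tgt e))
    (hloop : ∀ e, src e = tgt e → (c₁ e)⁻¹ * c₂ e ∉ Λv (src e))
    (hA1 : ∀ Λ : Subgroup D.Tp, IsCompact (Λ : Set D.Tp) → Λ ≠ ⊥ →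
      ∃ (v : G.graph.V) (t : D.Tp), Λ ≤ MulAut.conj t • Λv v) :
    D.ProfiniteConjugatesOfCompactSubgroups :=
  D.prop21_of_cosetTree_of_isTempered hT hRF Λv src tgt c₁ c₂ hA1
    (D.hA3_of_verticialIntersectionNear G hNN Λv hΛv src tgt c₁ c₂ hends h₁ h₂ hloop)

/-- **[IUTchI] Proposition 2.2, "in particular, `Π^tp_𝔾` is commensurably terminal in `Π̂_𝔾`", for
`D`, (A3) BY NAME from [NodNon] Lemma 1.9 (ii)**; the other inputs as in
`tp_isCommensurablyTerminal_of_cosetTree` (plus one infinite compact `Λ_{v₀}`).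
([IUTchI] Prop 2.2 p.45) [claim: Mochizuki2012, status: disputed] -/
theorem tp_isCommensurablyTerminal_of_psc [T2Space D.Hat] (hT : IsTempered D.Tp)
    (hRF : ∀ U ∈ 𝓝 (1 : D.Tp), ∃ N : OpenNormalSubgroup D.Tp, (N : Set D.Tp) ⊆ U ∧
      ((N.toSubgroup.map D.ι).topologicalClosure).comap D.ι ≤ N.toSubgroup)
    (G : PSCDatum D.Hat) (hNN : G.VerticialIntersectionNear)
    (Λv : G.graph.V → Subgroup D.Tp) (hΛv : ∀ v, (Λv v).map D.ι = G.vertGp v)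
    (src tgt : G.graph.N → G.graph.V) (c₁ c₂ : G.graph.N → D.Tp)
    (hends : ∀ e, G.graph.nodeEnds e = s(src e, tgt e))
    (h₁ : ∀ e, G.nodeGp e ≤ MulAut.conj (D.ι (c₁ e)) • G.vertGp (src e))
    (h₂ : ∀ e, G.nodeGp e ≤ MulAut.conj (D.ι (c₂ e)) • G.vertGp (tgt e))
    (hloop : ∀ e, src e = tgt e → (c₁ e)⁻¹ * c₂ e ∉ Λv (src e))
    (hA1 : ∀ Λ : Subgroup D.Tp, IsCompact (Λ : Set D.Tp) → Λ ≠ ⊥ →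
      ∃ (v : G.graph.V) (t : D.Tp), Λ ≤ MulAut.conj t • Λv v)
    (v₀ : G.graph.V) (hv₀c : IsCompact ((Λv v₀ : Subgroup D.Tp) : Set D.Tp))
    (hv₀inf : ((Λv v₀ : Subgroup D.Tp) : Set D.Tp).Infinite) :
    IsCommensurablyTerminal D.ι.range :=
  D.tp_isCommensurablyTerminal_of_cosetTree hT hRF Λv src tgt c₁ c₂ hA1
    (D.hA3_of_verticialIntersectionNear G hNN Λv hΛv src tgt c₁ c₂ hends h₁ h₂ hloop) v₀ hv₀c hv₀inf

/-- **[IUTchI] Remark 2.2.2 for `D` (normal terminality of `Π^tp_𝔾` in `Π̂_𝔾`), (A3) BY NAME** — from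
`tp_isCommensurablyTerminal_of_psc` ("a consequence of … Proposition 2.2", p. 46: commensurably
terminal implies normally terminal), for any `Σ̂`. ([IUTchI] Rmk 2.2.2 p.46) [claim: Mochizuki2012, status: disputed] -/
theorem temperedNormallyTerminal_of_psc [T2Space D.Hat] (hT : IsTempered D.Tp)
    (hRF : ∀ U ∈ 𝓝 (1 : D.Tp), ∃ N : OpenNormalSubgroup D.Tp, (N : Set D.Tp) ⊆ U ∧
      ((N.toSubgroup.map D.ι).topologicalClosure).comap D.ι ≤ N.toSubgroup)
    (G : PSCDatum D.Hat) (hNN : G.VerticialIntersectionNear)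
    (Λv : G.graph.V → Subgroup D.Tp) (hΛv : ∀ v, (Λv v).map D.ι = G.vertGp v)
    (src tgt : G.graph.N → G.graph.V) (c₁ c₂ : G.graph.N → D.Tp)
    (hends : ∀ e, G.graph.nodeEnds e = s(src e, tgt e))
    (h₁ : ∀ e, G.nodeGp e ≤ MulAut.conj (D.ι (c₁ e)) • G.vertGp (src e))
    (h₂ : ∀ e, G.nodeGp e ≤ MulAut.conj (D.ι (c₂ e)) • G.vertGp (tgt e))
    (hloop : ∀ e, src e = tgt e → (c₁ e)⁻¹ * c₂ e ∉ Λv (src e))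
    (hA1 : ∀ Λ : Subgroup D.Tp, IsCompact (Λ : Set D.Tp) → Λ ≠ ⊥ →
      ∃ (v : G.graph.V) (t : D.Tp), Λ ≤ MulAut.conj t • Λv v)
    (v₀ : G.graph.V) (hv₀c : IsCompact ((Λv v₀ : Subgroup D.Tp) : Set D.Tp))
    (hv₀inf : ((Λv v₀ : Subgroup D.Tp) : Set D.Tp).Infinite) :
    D.TemperedNormallyTerminal :=
  ⟨fun _ => (D.tp_isCommensurablyTerminal_of_psc hT hRF G hNN Λv hΛv src tgt c₁ c₂ hends h₁ h₂
    hloop hA1 v₀ hv₀c hv₀inf).isNormallyTerminal⟩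


/-! ### Everything BY NAME: chart + profinite completion + Galois domination + [NodNon] -/

variable {𝒢 : ProfiniteSemiGraph.{u}}

/-- **[IUTchI] Proposition 2.1 AS TYPED with EVERY printed input BY NAME.**  Data: t1's `D`
identified with a chart `c` of `π₁^temp(𝒢)` (`e`), `Π̂_𝔾` its profinite completion (`hPC`), a
`PSCDatum G` on `Π̂_𝔾` whose vertices are those of `𝒢` (`σ`) and whose representative verticial
subgroups are the images of the chosen verticial family (`hΛv`, `hvert`), tempered end-point data for
the nodes.  Named inputs: `CompactInVerticial` ([SemiAnbd] Thm 3.7 (iii)), `𝒢.Thm37Hypotheses`, the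
chart (Prop 3.6 (i)(ii)), `IsProfiniteCompletion` (Prop 3.6 (iii)), abc-iut-L3's Galois-domination
hypothesis (proof of Prop 3.6 (iii)), `PSCDatum.VerticialIntersectionNear` ([NodNon] Lem 1.9 (ii) =
"[AbsTopII] Prop 1.3 (iv) / [NodNon] Prop 3.9 (i)" of p. 45).
([IUTchI] Prop 2.1 p.45) [claim: Mochizuki2012, status: disputed] -/
theorem prop21_byName (c : TemperedPiChart 𝒢) (e : D.Tp ≃ₜ* c.G) (h𝒢 : 𝒢.Thm37Hypotheses)
    (hCV : CompactInVerticial.{u})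
    (hPC : IsProfiniteCompletion
      ({ toMonoidHom := D.ι, continuous_toFun := D.ι_continuous } : D.Tp →ₜ* D.Hat))
    (hGal : ∀ S : ProfiniteSemiGraph.BTempCat 𝒢,
      Literature.AlgebraicGeometry.Frobenioids.IsConnectedObj S →
      ∃ (H : ProfiniteSemiGraph.BTempCat 𝒢) (_ : H ⟶ S),
        Literature.AnabelianGeometry.SemiGraphs.IsGaloisObj H ∧
          Group.ResiduallyFinite (CategoryTheory.Aut H))
    (G : PSCDatum D.Hat) (hNN : G.VerticialIntersectionNear) (σ : 𝒢.graph.Vertex ≃ G.graph.V)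
    (Λv : G.graph.V → Subgroup D.Tp)
    (hvert : ∀ v : 𝒢.graph.Vertex, (Λv (σ v)).map (e : D.Tp →* c.G) ∈ verticialSubgroups c v)
    (hΛv : ∀ v, (Λv v).map D.ι = G.vertGp v)
    (src tgt : G.graph.N → G.graph.V) (c₁ c₂ : G.graph.N → D.Tp)
    (hends : ∀ e, G.graph.nodeEnds e = s(src e, tgt e))
    (h₁ : ∀ e, G.nodeGp e ≤ MulAut.conj (D.ι (c₁ e)) • G.vertGp (src e))
    (h₂ : ∀ e, G.nodeGp e ≤ MulAut.conj (D.ι (c₂ e)) • G.vertGp (tgt e))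
    (hloop : ∀ e, src e = tgt e → (c₁ e)⁻¹ * c₂ e ∉ Λv (src e)) :
    D.ProfiniteConjugatesOfCompactSubgroups :=
  D.prop21_of_cosetTree_of_isProfiniteCompletion (D.isTempered_tp_of_chart c e) hPC
    (D.exists_residuallyFinite_quotient_of_chart c e hGal) Λv src tgt c₁ c₂
    (fun Λ hΛc _ => by
      obtain ⟨v, t, h⟩ := D.conj_le_of_compactInVerticial c e h𝒢 hCV (fun v => Λv (σ v)) hvert Λ hΛc
      exact ⟨σ v, t, h⟩)
    (D.hA3_of_verticialIntersectionNear G hNN Λv hΛv src tgt c₁ c₂ hends h₁ h₂ hloop)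

/-- **[IUTchI] Proposition 2.2, "in particular, `Π^tp_𝔾` is commensurably terminal in `Π̂_𝔾`", with
EVERY printed input BY NAME** (as `prop21_byName`, plus `VerticialInjective`, [SemiAnbd] Thm 3.7 (i),
for "any verticial [hence, in particular, nontrivial compact!] subgroup").
([IUTchI] Prop 2.2 p.45) [claim: Mochizuki2012, status: disputed] -/
theorem prop22_inParticular_byName (c : TemperedPiChart 𝒢) (e : D.Tp ≃ₜ* c.G)
    (h𝒢 : 𝒢.Thm37Hypotheses) (hCV : CompactInVerticial.{u}) (hVI : VerticialInjective.{u})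
    (hPC : IsProfiniteCompletion
      ({ toMonoidHom := D.ι, continuous_toFun := D.ι_continuous } : D.Tp →ₜ* D.Hat))
    (hGal : ∀ S : ProfiniteSemiGraph.BTempCat 𝒢,
      Literature.AlgebraicGeometry.Frobenioids.IsConnectedObj S →
      ∃ (H : ProfiniteSemiGraph.BTempCat 𝒢) (_ : H ⟶ S),
        Literature.AnabelianGeometry.SemiGraphs.IsGaloisObj H ∧
          Group.ResiduallyFinite (CategoryTheory.Aut H))
    (G : PSCDatum D.Hat) (hNN : G.VerticialIntersectionNear) (σ : 𝒢.graph.Vertex ≃ G.graph.V)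
    (Λv : G.graph.V → Subgroup D.Tp)
    (hvert : ∀ v : 𝒢.graph.Vertex, (Λv (σ v)).map (e : D.Tp →* c.G) ∈ verticialSubgroups c v)
    (hΛv : ∀ v, (Λv v).map D.ι = G.vertGp v)
    (src tgt : G.graph.N → G.graph.V) (c₁ c₂ : G.graph.N → D.Tp)
    (hends : ∀ e, G.graph.nodeEnds e = s(src e, tgt e))
    (h₁ : ∀ e, G.nodeGp e ≤ MulAut.conj (D.ι (c₁ e)) • G.vertGp (src e))
    (h₂ : ∀ e, G.nodeGp e ≤ MulAut.conj (D.ι (c₂ e)) • G.vertGp (tgt e))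
    (hloop : ∀ e, src e = tgt e → (c₁ e)⁻¹ * c₂ e ∉ Λv (src e)) :
    IsCommensurablyTerminal D.ι.range := by
  obtain ⟨v₀, hv₀c, hv₀inf⟩ :=
    D.exists_infinite_compact_of_chart c e h𝒢 hVI (fun v => Λv (σ v)) hvert
  exact D.tp_isCommensurablyTerminal_of_cosetTree_of_isProfiniteCompletion
    (D.isTempered_tp_of_chart c e) hPC (D.exists_residuallyFinite_quotient_of_chart c e hGal) Λv
    src tgt c₁ c₂
    (fun Λ hΛc _ => by
      obtain ⟨v, t, h⟩ := D.conj_le_of_compactInVerticial c e h𝒢 hCV (fun v => Λv (σ v)) hvert Λ hΛc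
      exact ⟨σ v, t, h⟩)
    (D.hA3_of_verticialIntersectionNear G hNN Λv hΛv src tgt c₁ c₂ hends h₁ h₂ hloop) (σ v₀)
    hv₀c hv₀inf

end TemperedGraphGroupData

end Literature.IUT.HodgeTheaters
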